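import Literature.AlgebraicGeometry.Motives.LangWeilEstimateOfRiemannHypothesis
import HarnessLib

/-!
# Frobenius eigenvalues divisible by `q` force `#X(𝔽_{q^m}) ≡ 1 (mod q^m)`, hence a rational point
# (Esnault, *Varieties over a finite field with trivial Chow group of 0-cycles have a rational point*)

Topic `Literature/AlgebraicGeometry/Motives`; THEOREMS ONLY (no definition, no instance, no named fact;
D-0026).  The elementary half of Esnault's theorem, for the tree's abstract Galois Weil cohomology
`E : GaloisWeilCohomology k K χ` over a finite field `k` (`q = #k`) with the Lefschetz trace formula and
`χ(φ) = q`: the cohomological hypothesis «all the slopes of Frob are `≥ 1`» on `Hⁱ(X)`, `i > 0`, is taken in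
the polynomial form **`Pᵢ(X, T) = det(1 − T·F | Hⁱ(X)) = Qᵢ(qT)` with `Qᵢ ∈ ℤ[T]`** — equivalently, every
reciprocal root `α` of the integral model of `Pᵢ` is `q` times an algebraic integer (the reciprocal roots of
`Qᵢ ∈ ℤ[T]`, `Qᵢ(0) = 1`, are roots of the monic reversed polynomial, hence algebraic integers; conversely
`∏ (1 − (α/q)T)` has rational, integral-algebraic coefficients).  The geometric half (`CH₀` trivial over
`k(X)̄` ⟹ slopes `≥ 1`, Bloch's decomposition of the diagonal in rigid cohomology) is not touched.

## Sources, verbatim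

H. Esnault, *Varieties over a finite field with trivial Chow group of 0-cycles have a rational point*,
Invent. Math. 151 (2003) 187–191 [Esnault2003], p. 188: «Theorem 1. Let `X` be a smooth projective variety
over a perfect field `k` of characteristic `p > 0`.  If the Chow group of 0-cycles `CH₀(X ×_k k(X)̄)` is equal
to `ℤ`, then the slope `[0 1[` part of `Hⁱ(X/K)` is vanishing for `i > 0`.  On the other hand, if one now
assumes that `k = 𝔽_q` is a finite field, with `q = pⁿ`, the Lefschetz trace formula for crystalline
cohomology … `|X(k)| = Σᵢ (−1)ⁱ Trace(Frobⁿ | Hⁱ(X/K))` implies in particular that if all the slopes of Frob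
are `≥ 1` and `X` is geometrically connected, then `|X(k)| ≡ 1 modulo q`.  Thus one has Corollary 2. Let `X`
be a smooth, projective, geometrically connected variety over a finite field `k`.  If the Chow group of
0-cycles `CH₀(X ×_k k(X)̄)` is equal to `ℤ`, then `X` has a rational point over `k`.  … Corollary 3. Let `X`
be a Fano variety over a finite field `k` … Then `X` has a rational point.»
P. Deligne, *La conjecture de Weil. I* [Deligne1974], (1.5.1) (trace formula) and (1.5.3)
(`tr(F^m) = Σ αⱼ^m`).  R. Hartshorne, *Algebraic Geometry* [Hartshorne1977], App. C Ex. 5.7 (a)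
(`N_r = Σ (−1)ⁱ Σⱼ α_{ij}^r`).

## What is here

* §1 (pure) `sum_roots_inv_pow_comp_C_mul_X` (the reciprocal roots of `Q(cT)` are `c` times those of `Q`:
  `Σ_z z^{−m}` over the roots of `Q(cT)` is `c^m Σ_w w^{−m}` over the roots of `Q`),
  `exists_int_cast_eq_sum_roots_inv_pow` (the power sums of the reciprocal roots of `Q ∈ ℤ[T]`, `Q(0) = 1`,
  are rational integers — the tree's `WeilEstimate.intCast_coeff_logDerivInt_eq_sum_roots`, BY NAME).
* §2 (E-level, `X` smooth projective of dimension `d`; stated for a modulus `c ≥ 1`, Esnault's case being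
  `c = q`, and `c = q^σ` the case of slopes `≥ σ`) **`exists_int_frobTracePow_eq_pow_mul`**:
  `Pᵢ(X, T) = Qᵢ(cT)` with `Qᵢ ∈ ℤ[T]` ⟹ `tr(F^m | Hⁱ(X)) = c^m · s`, `s ∈ ℤ` (`m ≥ 1`);
  **`pointCount_intCast_modEq_one`** (`#X(𝔽_{q^m}) ≡ 1 (mod c^m)` when this holds for all `1 ≤ i ≤ 2d`),
  `pointCount_modEq_one` (in `ℕ`), **`pointCount_pos`** (`#X(𝔽_{q^m}) ≥ 1` for `c ≥ 2`: «`X` has a rational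
  point»), and `pointCount_intCast_modEq_one_of_forall_dvd` (the same from the trace hypothesis
  `c^m ∣ tr(F^m | Hⁱ(X))` in `ℤ`, `i ≥ 1`).

HC is not touched.

## References

* [Esnault2003] H. Esnault, *Varieties over a finite field with trivial Chow group of 0-cycles have a rational
  point*, Invent. Math. 151 (2003), 187–191, Theorem 1, (1.3), Corollaries 2–3 (p. 188).
* [Deligne1974] P. Deligne, *La conjecture de Weil. I*, Publ. Math. IHÉS 43 (1974), (1.5.1), (1.5.3).
* [Hartshorne1977] R. Hartshorne, *Algebraic Geometry*, App. C Ex. 5.7 (a).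

## Provenance

Lane `lit-hodgefound` (summit `HodgeConjecture`, Track 2 foundations library, Layer B: motives / zeta
functions), seat `lit-hodgefound-p29` (literature-prover, generation 44, row g44-#4).
-/

universe u v

open Polynomial

noncomputable section

/-! ### §1 Reciprocal roots of `Q(cT)` and integrality of power sums -/

namespace Literature.NumberTheory.LFunctions

namespace WeilEstimate

/-- **The reciprocal roots of `Q(cT)` are `c` times those of `Q`**: for `c ≠ 0` in a field,
`Σ_{z : Q(cz) = 0} z^{−m} = c^m · Σ_{w : Q(w) = 0} w^{−m}` (multisets of roots with multiplicity).
[cite: Deligne1974, (1.5.3)] [cite: Esnault2003, p. 188 (1.3)] -/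
theorem sum_roots_inv_pow_comp_C_mul_X {F : Type*} [Field F] (Q : F[X]) {c : F} (hc : c ≠ 0) (m : ℕ) :
    ((Q.comp (C c * X)).roots.map fun z => z⁻¹ ^ m).sum = c ^ m * (Q.roots.map fun w => w⁻¹ ^ m).sum := by
  have h := roots_comp_C_mul_X_add_C Q c 0 (isUnit_iff_ne_zero.mpr hc)
  rw [map_zero, add_zero] at h
  rw [h, Multiset.map_map, ← Multiset.sum_map_mul_left]
  refine congrArg _ (Multiset.map_congr rfl fun w _ => ?_)
  simp only [Function.comp_apply, sub_zero, Ring.inverse_eq_inv', mul_inv, inv_inv, mul_pow]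

/-- **The power sums of the reciprocal roots of `Q ∈ ℤ[T]`, `Q(0) = 1`, are rational integers**
(`Σ_w w^{−(m+1)} = [Tᵐ](−Q′/Q) ∈ ℤ`; the tree's `intCast_coeff_logDerivInt_eq_sum_roots`).
[cite: Deligne1974, (1.5.3) and Th. (1.6)] [cite: Hartshorne1977, App. C Ex. 5.7 (a)] -/
theorem exists_int_cast_eq_sum_roots_inv_pow {Q : ℤ[X]} (h0 : Q.coeff 0 = 1) (m : ℕ) :
    ∃ s : ℤ, (s : ℂ) = ((Q.map (Int.castRingHom ℂ)).roots.map fun w => w⁻¹ ^ (m + 1)).sum :=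
  ⟨_, intCast_coeff_logDerivInt_eq_sum_roots h0 m⟩

end WeilEstimate

end Literature.NumberTheory.LFunctions

/-! ### §2 The Galois Weil cohomology theory: traces divisible by `q^m` and the congruence -/

namespace Literature.AlgebraicGeometry.Motives

namespace GaloisWeilCohomology

open Literature.NumberTheory.LFunctions

variable {k : Type u} [Field k] [Finite k] {K : Type v} [Field K] [CharZero K]
  {χ : Field.absoluteGaloisGroup k →* Kˣ} (E : GaloisWeilCohomology k K χ)
variable {d : ℕ} {X : SchemeOver k}

/-- **`Pᵢ(X, T) = Qᵢ(cT)`, `Qᵢ ∈ ℤ[T]`, `c ≥ 1` ⟹ `tr(F^m | Hⁱ(X)) = c^m · s` with `s ∈ ℤ`** (`m ≥ 1`): the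
reciprocal roots `α = c β` of `Pᵢ` have power sums `Σ α^m = c^m Σ β^m`, and `Σ β^m ∈ ℤ` because the `β` are
the reciprocal roots of the integral polynomial `Qᵢ` (`c = q`: Esnault's «all the slopes of Frob are `≥ 1`»;
`c = q^σ`: slopes `≥ σ`). [cite: Esnault2003, p. 188 (1.3)] [cite: Deligne1974, (1.5.3)] -/
theorem exists_int_frobTracePow_eq_pow_mul (hX : IsSmoothProjective d X) {i : ℕ} {c : ℕ} (hc : c ≠ 0)
    {Q : ℤ[X]} (hQ : E.IsIntegralModel X i (Q.comp (C (c : ℤ) * Polynomial.X))) {m : ℕ} (hm : 0 < m) :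
    ∃ s : ℤ, E.frobTracePow X i m = (((c : ℤ) ^ m * s : ℤ) : K) := by
  obtain ⟨m, rfl⟩ : ∃ j, m = j + 1 := ⟨m - 1, by omega⟩
  have hq0 : (c : ℂ) ≠ 0 := by exact_mod_cast hc
  -- `Q(0) = 1`
  have hQ0 : Q.coeff 0 = 1 := by
    have h := E.coeff_zero_eq_one_of_isIntegralModel hQ
    rwa [coeff_zero_eq_eval_zero, eval_comp, eval_mul, eval_C, eval_X, mul_zero,
      ← coeff_zero_eq_eval_zero] at h
  obtain ⟨t, ht, htC⟩ := E.exists_int_frobTracePow_succ_eq_sum_roots hX hQ m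
  obtain ⟨s, hs⟩ := WeilEstimate.exists_int_cast_eq_sum_roots_inv_pow hQ0 m
  refine ⟨s, ?_⟩
  rw [ht]
  congr 1
  apply Int.cast_injective (α := ℂ)
  rw [htC, Polynomial.map_comp, Polynomial.map_mul, Polynomial.map_C, Polynomial.map_X, eq_intCast,
    Int.cast_natCast, WeilEstimate.sum_roots_inv_pow_comp_C_mul_X _ hq0, ← hs]
  push_cast
  ring

/-- **Esnault's congruence `#X(𝔽_{q^m}) ≡ 1 (mod c^m)`** (in `ℤ`; `c = q` in Esnault's statement, `c = q^σ`
for slopes `≥ σ`): for `E` with the Lefschetz trace formula and `χ(φ) = q`, `X` smooth projective of dimension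
`d`, if for every `1 ≤ i ≤ 2d` the polynomial `Pᵢ(X, T) = det(1 − T·F | Hⁱ(X))` is `Qᵢ(cT)` for some
`Qᵢ ∈ ℤ[T]` («all the slopes of Frob are `≥ 1`» on `Hⁱ`, `i > 0`, when `c = q`), then
`#X(𝔽_{q^m}) ≡ 1 (mod c^m)` for all `m ≥ 1` (`tr(Fᵐ | H⁰(X)) = 1`, all other traces are divisible by `c^m`).
[cite: Esnault2003, p. 188 (1.3) and Corollary 2] [cite: Deligne1974, (1.5.1)] -/
theorem pointCount_intCast_modEq_one (hE : E.HasLefschetzTraceFormula)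
    (hχ : ((χ (arithFrob k) : Kˣ) : K) = Nat.card k) (hX : IsSmoothProjective d X) {c : ℕ} (hc : c ≠ 0)
    (hQ : ∀ i, 1 ≤ i → i ≤ 2 * d →
      ∃ Q : ℤ[X], E.IsIntegralModel X i (Q.comp (C (c : ℤ) * Polynomial.X)))
    {m : ℕ} (hm : 0 < m) :
    (pointCount X m : ℤ) ≡ 1 [ZMOD (c : ℤ) ^ m] := by
  -- integer traces `tr(Fᵐ | Hⁱ) = c^m sᵢ` for `1 ≤ i ≤ 2d`
  have htr : ∀ i ∈ Finset.range (2 * d + 1), ∃ s : ℤ,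
      (-1 : K) ^ i * E.frobTracePow X i m = ((if i = 0 then 1 else (c : ℤ) ^ m * s : ℤ) : K) := by
    intro i hi
    rcases Nat.eq_zero_or_pos i with rfl | hi0
    · exact ⟨0, by rw [pow_zero, one_mul, E.frobTracePow_zero hχ hX m, if_pos rfl, Int.cast_one]⟩
    · obtain ⟨Q, hQi⟩ := hQ i hi0 (by have := Finset.mem_range.mp hi; omega)
      obtain ⟨s, hs⟩ := E.exists_int_frobTracePow_eq_pow_mul hX hc hQi hm
      refine ⟨(-1) ^ i * s, ?_⟩
      rw [hs, if_neg hi0.ne']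
      push_cast
      ring
  choose! s hs using htr
  have hN : (pointCount X m : K) =
      ((∑ i ∈ Finset.range (2 * d + 1), (if i = 0 then 1 else (c : ℤ) ^ m * s i) : ℤ) : K) := by
    rw [hE hX m hm, Int.cast_sum]
    exact Finset.sum_congr rfl fun i hi => hs i hi
  have hZ : (pointCount X m : ℤ) = ∑ i ∈ Finset.range (2 * d + 1), (if i = 0 then 1 else (c : ℤ) ^ m * s i) := by
    have h : ((pointCount X m : ℤ) : K) =
        ((∑ i ∈ Finset.range (2 * d + 1), (if i = 0 then 1 else (c : ℤ) ^ m * s i) : ℤ) : K) := by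
      rw [← hN, Int.cast_natCast]
    exact Int.cast_injective h
  rw [hZ, Finset.sum_range_succ', if_pos rfl]
  -- the remaining terms are multiples of `q^m`
  have hdvd : ((c : ℤ) ^ m) ∣
      ∑ i ∈ Finset.range (2 * d), (if i + 1 = 0 then 1 else (c : ℤ) ^ m * s (i + 1)) :=
    Finset.dvd_sum fun i _ => by
      rw [if_neg (Nat.succ_ne_zero i)]
      exact Dvd.intro _ rfl
  calc ∑ i ∈ Finset.range (2 * d), (if i + 1 = 0 then 1 else (c : ℤ) ^ m * s (i + 1)) + (1 : ℤ)
      ≡ 0 + 1 [ZMOD (c : ℤ) ^ m] :=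
        Int.ModEq.add_right 1 (Int.modEq_zero_iff_dvd.mpr hdvd)
    _ = 1 := zero_add 1

/-- **`#X(𝔽_{q^m}) ≡ 1 (mod c^m)` in `ℕ`** under the same hypotheses. [cite: Esnault2003, p. 188 (1.3)] -/
theorem pointCount_modEq_one (hE : E.HasLefschetzTraceFormula)
    (hχ : ((χ (arithFrob k) : Kˣ) : K) = Nat.card k) (hX : IsSmoothProjective d X) {c : ℕ} (hc : c ≠ 0)
    (hQ : ∀ i, 1 ≤ i → i ≤ 2 * d →
      ∃ Q : ℤ[X], E.IsIntegralModel X i (Q.comp (C (c : ℤ) * Polynomial.X)))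
    {m : ℕ} (hm : 0 < m) :
    pointCount X m ≡ 1 [MOD c ^ m] := by
  have h := E.pointCount_intCast_modEq_one hE hχ hX hc hQ hm
  rw [← Int.natCast_modEq_iff]
  exact_mod_cast h

/-- **«`X` has a rational point»**: `#X(𝔽_{q^m}) ≥ 1` for every `m ≥ 1` under the same hypotheses with
`c ≥ 2` (e.g. `c = q`): `#X(𝔽_{q^m}) ≡ 1 (mod c^m)` and `c^m > 1`. [cite: Esnault2003, p. 188 Corollary 2 and Corollary 3] -/
theorem pointCount_pos (hE : E.HasLefschetzTraceFormula)
    (hχ : ((χ (arithFrob k) : Kˣ) : K) = Nat.card k) (hX : IsSmoothProjective d X) {c : ℕ} (hc : 1 < c)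
    (hQ : ∀ i, 1 ≤ i → i ≤ 2 * d →
      ∃ Q : ℤ[X], E.IsIntegralModel X i (Q.comp (C (c : ℤ) * Polynomial.X)))
    {m : ℕ} (hm : 0 < m) : 0 < pointCount X m := by
  have h := E.pointCount_modEq_one hE hχ hX (by omega) hQ hm
  have hq : 1 < c ^ m := Nat.one_lt_pow hm.ne' hc
  by_contra h0
  rw [Nat.eq_zero_of_not_pos h0, Nat.ModEq, Nat.zero_mod, Nat.mod_eq_of_lt hq] at h
  exact zero_ne_one h

/-- **The congruence from the trace hypothesis**: if `tr(Fᵐ | Hⁱ(X))` is an integer divisible by `c^m` for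
every `1 ≤ i ≤ 2d` (e.g. `c = q` when all eigenvalues of `F` on `Hⁱ(X)`, `i > 0`, are divisible by `q` among
algebraic integers), then `#X(𝔽_{q^m}) ≡ 1 (mod c^m)`. [cite: Esnault2003, p. 188 (1.3)] [cite: Deligne1974, (1.5.1)] -/
theorem pointCount_intCast_modEq_one_of_forall_dvd (hE : E.HasLefschetzTraceFormula)
    (hχ : ((χ (arithFrob k) : Kˣ) : K) = Nat.card k) (hX : IsSmoothProjective d X) (c : ℤ) {m : ℕ}
    (hm : 0 < m) (htr : ∀ i, 1 ≤ i → i ≤ 2 * d → ∃ t : ℤ, E.frobTracePow X i m = (t : K) ∧ (c ^ m) ∣ t) :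
    (pointCount X m : ℤ) ≡ 1 [ZMOD c ^ m] := by
  have htr' : ∀ i ∈ Finset.range (2 * d + 1), ∃ s : ℤ,
      (-1 : K) ^ i * E.frobTracePow X i m = ((if i = 0 then 1 else c ^ m * s : ℤ) : K) := by
    intro i hi
    rcases Nat.eq_zero_or_pos i with rfl | hi0
    · exact ⟨0, by rw [pow_zero, one_mul, E.frobTracePow_zero hχ hX m, if_pos rfl, Int.cast_one]⟩
    · obtain ⟨t, ht, ⟨s, rfl⟩⟩ := htr i hi0 (by have := Finset.mem_range.mp hi; omega)
      refine ⟨(-1) ^ i * s, ?_⟩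
      rw [ht, if_neg hi0.ne']
      push_cast
      ring
  choose! s hs using htr'
  have hZ : (pointCount X m : ℤ) =
      ∑ i ∈ Finset.range (2 * d + 1), (if i = 0 then 1 else c ^ m * s i) := by
    have h : ((pointCount X m : ℤ) : K) =
        ((∑ i ∈ Finset.range (2 * d + 1), (if i = 0 then 1 else c ^ m * s i) : ℤ) : K) := by
      rw [Int.cast_natCast, hE hX m hm, Int.cast_sum]
      exact Finset.sum_congr rfl fun i hi => hs i hi
    exact Int.cast_injective h
  rw [hZ, Finset.sum_range_succ', if_pos rfl]
  -- the remaining terms are multiples of `q^m`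
  have hdvd : (c ^ m) ∣
      ∑ i ∈ Finset.range (2 * d), (if i + 1 = 0 then 1 else c ^ m * s (i + 1)) :=
    Finset.dvd_sum fun i _ => by
      rw [if_neg (Nat.succ_ne_zero i)]
      exact Dvd.intro _ rfl
  calc ∑ i ∈ Finset.range (2 * d), (if i + 1 = 0 then 1 else c ^ m * s (i + 1)) + (1 : ℤ)
      ≡ 0 + 1 [ZMOD c ^ m] :=
        Int.ModEq.add_right 1 (Int.modEq_zero_iff_dvd.mpr hdvd)
    _ = 1 := zero_add 1

end GaloisWeilCohomology

end Literature.AlgebraicGeometry.Motives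

end
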